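import Literature.NumberTheory.EllipticCurves.NeronModelWeilAlgebra
import Literature.AlgebraicGeometry.Resolution.RegularLocalRingsUFD
import Literature.AlgebraicGeometry.Resolution.StalkSpecializesLocalization
import Literature.AlgebraicGeometry.Resolution.FiniteBirationalNormal
import Mathlib.AlgebraicGeometry.FunctionField
import Mathlib.AlgebraicGeometry.Noetherian
import Mathlib.AlgebraicGeometry.ZariskisMainTheorem
import Mathlib.AlgebraicGeometry.Morphisms.QuasiFinite
import Mathlib.AlgebraicGeometry.Morphisms.Separated
import HarnessLib

/-!
# Purity of the exceptional locus of a birational morphism into a regular scheme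
# (van der Waerden; EGA IV 21.12.12)

Topic: `Literature/AlgebraicGeometry/Resolution`, namespace `Literature.AlgebraicGeometry.Resolution`.
THEOREMS ONLY (no definition, no named fact, no instance).

Let `f : X → Y` be a morphism of schemes, `X` integral and locally noetherian, `x ∈ X`, `y = f(x)`,
and suppose `𝒪_{Y,y}` is a regular local ring and `f` is *birational at `x`*: the composite
`𝒪_{Y,y} → 𝒪_{X,x} → K(X)` makes the function field `K(X)` of `X` the fraction field of `𝒪_{Y,y}`.
The *exceptional locus* of `f` is the set of points at which `𝒪_{Y,f(x)} → 𝒪_{X,x}` is not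
bijective.  **Purity** (van der Waerden; EGA IV 21.12.12 for `Y` locally factorial): if `x` is
exceptional then so is some generization `x' ⤳ x` of codimension `dim 𝒪_{X,x'} ≤ 1` — the
exceptional locus is of pure codimension one.  Equivalently (the form proved,
`stalkMap_surjective_of_forall_ringKrullDim_le_one`): if `𝒪_{Y,f(x')} → 𝒪_{X,x'}` is surjective
for every generization `x'` of `x` with `dim 𝒪_{X,x'} ≤ 1`, then `𝒪_{Y,y} → 𝒪_{X,x}` is surjective
(hence bijective, `stalkMap_bijective_of_forall_ringKrullDim_le_one`).

Proof.  `A = 𝒪_{Y,y}` is factorial (Auslander–Buchsbaum, the tree's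
`uniqueFactorizationMonoid_of_isRegularLocalRing`) and `B = 𝒪_{X,x} ⊆ L = K(X) = Frac A` is a
noetherian local ring dominating `A`.  By the factorial Hartogs lemma of the tree
(`Literature.NumberTheory.EllipticCurves.subset_range_algebraMap_of_forall_height_le_one`, the last
paragraph of Artin's proof of Weil's extension theorem) it suffices that for every prime `𝔮 ⊂ B`
of height `≤ 1` every `b ∈ B` is a fraction `a/s` with `a, s ∈ A`, `s ∉ 𝔮`; but `𝔮` is the centre
of a generization `x' ⤳ x` with `𝒪_{X,x'} = B_𝔮` of dimension `ht 𝔮 ≤ 1`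
(`exists_specializes_comap_stalkSpecializes_eq`, `isLocalizationAtPrime_stalkSpecializes`), and
`𝒪_{Y,f(x')} = A_{𝔮 ∩ A} → B_𝔮` is surjective by hypothesis.  The local-algebra form is
`surjective_of_forall_height_le_one`.

## References
* A. Grothendieck, J. Dieudonné, *EGA IV₄*, Publ. Math. IHÉS 32 (1967), 21.12.12.
* B. L. van der Waerden, *Zur algebraischen Geometrie VI* (purity of the fundamental locus), Math. Ann. 110 (1934).
* O. Debarre, *Higher-Dimensional Algebraic Geometry*, Springer 2001, 1.40.
* M. Artin, *Néron Models*, in Cornell–Silverman (eds.), *Arithmetic Geometry*, Springer 1986, Prop. (1.3), proof (p. 215).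
-/

noncomputable section

universe u

open CategoryTheory AlgebraicGeometry IsLocalRing

namespace Literature.AlgebraicGeometry.Resolution

/-! ### Local algebra -/

/-- **van der Waerden purity, local-algebra form.**  Let `A` be a factorial domain with fraction
field `L`, `B ⊆ L` a noetherian local ring and `σ : A → B` a local homomorphism compatible with the
embeddings into `L` (so `B` dominates `A` birationally).  If for every prime `𝔮` of `B` of height
`≤ 1` every `b ∈ B` satisfies `b σ(s) = σ(a)` for some `a, s ∈ A` with `σ(s) ∉ 𝔮` (i.e.
`A_{σ⁻¹𝔮} → B_𝔮` is surjective), then `σ` is surjective.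
[cite: EGAIV4, 21.12.12] [cite: Artin1986NeronModels, Prop. (1.3), proof (p. 215)] -/
theorem surjective_of_forall_height_le_one {A B L : Type*} [CommRing A] [IsDomain A]
    [UniqueFactorizationMonoid A] [CommRing B] [IsLocalRing B] [IsNoetherianRing B] [Field L]
    [Algebra A L] [IsFractionRing A L] [Algebra B L]
    (hinj : Function.Injective (algebraMap B L)) (σ : A →+* B) [IsLocalHom σ]
    (hσ : ∀ a, algebraMap B L (σ a) = algebraMap A L a)
    (H : ∀ (q : Ideal B) [q.IsPrime], q.height ≤ 1 →
      ∀ b : B, ∃ a s : A, σ s ∉ q ∧ b * σ s = σ a) :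
    Function.Surjective σ := by
  intro b
  have hT : Set.range (algebraMap B L) ⊆ Set.range (algebraMap A L) := by
    refine Literature.NumberTheory.EllipticCurves.subset_range_algebraMap_of_forall_height_le_one
      σ _ ?_
    intro q _ hq t ht
    obtain ⟨b', rfl⟩ := ht
    obtain ⟨a, s, hs, hbs⟩ := H q hq b'
    exact ⟨a, s, hs, by rw [← hσ s, ← map_mul, hbs, hσ]⟩
  obtain ⟨a, ha⟩ := hT ⟨b, rfl⟩
  exact ⟨a, hinj (by rw [hσ, ha])⟩

/-! ### Schemes -/

variable {X Y : Scheme.{u}} (f : X ⟶ Y)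

/-- **Purity of the exceptional locus** (van der Waerden; EGA IV 21.12.12).  Let `f : X → Y` be a
morphism, `X` integral and locally noetherian, `x ∈ X` with `𝒪_{Y,f(x)}` regular, and `f`
birational at `x` (`K(X)` is the fraction field of `𝒪_{Y,f(x)}` along `𝒪_{Y,f(x)} → 𝒪_{X,x} → K(X)`).
If `𝒪_{Y,f(x')} → 𝒪_{X,x'}` is surjective for every generization `x' ⤳ x` with
`dim 𝒪_{X,x'} ≤ 1`, then `𝒪_{Y,f(x)} → 𝒪_{X,x}` is surjective: an exceptional point has an
exceptional generization of codimension `≤ 1`.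
[cite: EGAIV4, 21.12.12] [cite: Debarre2001, 1.40] -/
theorem stalkMap_surjective_of_forall_ringKrullDim_le_one [IsIntegral X] [IsLocallyNoetherian X]
    (x : X) (hreg : IsRegularLocalRing (Y.presheaf.stalk (f.base x)))
    (hbir : letI := ((algebraMap (X.presheaf.stalk x) X.functionField).comp
        (f.stalkMap x).hom).toAlgebra
      IsFractionRing (Y.presheaf.stalk (f.base x)) X.functionField)
    (h1 : ∀ x' : X, x' ⤳ x → ringKrullDim (X.presheaf.stalk x') ≤ 1 →
      Function.Surjective (f.stalkMap x')) :
    Function.Surjective (f.stalkMap x) := by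
  classical
  set A := Y.presheaf.stalk (f.base x) with hA
  set B := X.presheaf.stalk x with hB
  let σ : A →+* B := (f.stalkMap x).hom
  letI algAL : Algebra A X.functionField :=
    ((algebraMap B X.functionField).comp σ).toAlgebra
  haveI : IsFractionRing A X.functionField := hbir
  haveI : IsDomain A := isDomain_of_isRegularLocalRing A
  haveI : UniqueFactorizationMonoid A := uniqueFactorizationMonoid_of_isRegularLocalRing A hreg
  have hinj : Function.Injective (algebraMap B X.functionField) :=
    IsFractionRing.injective B X.functionField
  refine surjective_of_forall_height_le_one (L := X.functionField) hinj σ (fun a => rfl) ?_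
  intro q _ hq b
  -- the generization `x'` of `x` with centre `q`, and its image `y'`
  obtain ⟨x', hx, hqx⟩ := exists_specializes_comap_stalkSpecializes_eq x q
  subst hqx
  let spX : B →+* X.presheaf.stalk x' := (X.presheaf.stalkSpecializes hx).hom
  letI algX : Algebra B (X.presheaf.stalk x') := spX.toAlgebra
  set q := (maximalIdeal (X.presheaf.stalk x')).comap spX with hqx
  haveI hlocX : IsLocalization.AtPrime (X.presheaf.stalk x') q :=
    isLocalizationAtPrime_stalkSpecializes hx
  have hy : f.base x' ⤳ f.base x := hx.map f.base.hom.continuous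
  let spY : A →+* Y.presheaf.stalk (f.base x') := (Y.presheaf.stalkSpecializes hy).hom
  letI algY : Algebra A (Y.presheaf.stalk (f.base x')) := spY.toAlgebra
  set p : Ideal A := (maximalIdeal (Y.presheaf.stalk (f.base x'))).comap spY with hp
  haveI hlocY : IsLocalization.AtPrime (Y.presheaf.stalk (f.base x')) p :=
    isLocalizationAtPrime_stalkSpecializes hy
  let σ' : Y.presheaf.stalk (f.base x') →+* X.presheaf.stalk x' := (f.stalkMap x').hom
  -- naturality of the stalk maps with respect to specialization
  have hnat : ∀ a : A, σ' (spY a) = spX (σ a) := fun a =>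
    Scheme.Hom.stalkSpecializes_stalkMap_apply f x' x hx a
  -- `dim 𝒪_{X,x'} = ht q ≤ 1`, so `σ'` is surjective
  have hdim : ringKrullDim (X.presheaf.stalk x') ≤ 1 := by
    rw [IsLocalization.AtPrime.ringKrullDim_eq_height q (X.presheaf.stalk x')]
    exact_mod_cast hq
  obtain ⟨c, hc⟩ := h1 x' hx hdim (spX b)
  -- `c = a / s` with `s ∉ p`
  obtain ⟨⟨a, s⟩, hcs⟩ := IsLocalization.mk'_surjective p.primeCompl c
  refine ⟨a, s, ?_, ?_⟩
  · -- `σ s ∉ q`: otherwise `σ'(spY s) = spX (σ s)` is a non-unit, so `spY s` is, so `s ∈ p`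
    intro hs
    have h1' : spX (σ ↑s) ∈ maximalIdeal (X.presheaf.stalk x') := Ideal.mem_comap.mp hs
    have h2' : spY ↑s ∈ maximalIdeal (Y.presheaf.stalk (f.base x')) := by
      rw [IsLocalRing.mem_maximalIdeal, mem_nonunits_iff] at h1' ⊢
      intro hu
      exact h1' (by rw [← hnat]; exact hu.map σ')
    exact s.2 (Ideal.mem_comap.mpr h2')
  · -- `b σ(s) = σ(a)` after localisation at `q`, and `B → B_q` is injective
    have key : spX (b * σ s) = spX (σ a) := by
      rw [map_mul, ← hnat, ← hnat, ← hc, ← map_mul]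
      congr 1
      rw [← hcs]
      exact IsLocalization.mk'_spec _ a s
    exact IsLocalization.injective (M := q.primeCompl) (S := X.presheaf.stalk x')
      (Ideal.primeCompl_le_nonZeroDivisors q) key

/-- **Purity of the exceptional locus, global form.**  Let `f : X → Y` be a birational morphism of
integral schemes (`f` maps the generic point to the generic point and induces a bijection
`𝒪_{Y,η_Y} = K(Y) → K(X) = 𝒪_{X,η_X}`), `X` locally noetherian.  If `𝒪_{Y,f(x')} → 𝒪_{X,x'}` is
surjective at every point `x'` with `dim 𝒪_{X,x'} ≤ 1`, then `𝒪_{Y,f(x)} → 𝒪_{X,x}` is bijective at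
every point `x` at which `𝒪_{Y,f(x)}` is regular: the exceptional locus of `f` over the regular
locus of `Y` is empty as soon as it contains no point of codimension `≤ 1`.
[cite: EGAIV4, 21.12.12] [cite: Debarre2001, 1.40] -/
theorem stalkMap_bijective_of_forall_ringKrullDim_le_one [IsIntegral X] [IsLocallyNoetherian X]
    [IsIntegral Y] (hη : f.base (genericPoint X) = genericPoint Y)
    (hbir : Function.Bijective (f.stalkMap (genericPoint X)))
    (h1 : ∀ x' : X, ringKrullDim (X.presheaf.stalk x') ≤ 1 → Function.Surjective (f.stalkMap x'))
    (x : X) (hreg : IsRegularLocalRing (Y.presheaf.stalk (f.base x))) :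
    Function.Bijective (f.stalkMap x) := by
  have hgx : genericPoint X ⤳ x := (genericPoint_spec X).specializes trivial
  have hgy : genericPoint Y ⤳ f.base x := (genericPoint_spec Y).specializes trivial
  have hfx : f.base (genericPoint X) ⤳ f.base x := hgx.map f.base.hom.continuous
  have h₀ : f.base (genericPoint X) ⤳ genericPoint Y := by rw [hη]
  let φ : Y.presheaf.stalk (f.base (genericPoint X)) →+* X.functionField :=
    (f.stalkMap (genericPoint X)).hom
  let c : Y.functionField →+* Y.presheaf.stalk (f.base (genericPoint X)) :=
    (Y.presheaf.stalkSpecializes h₀).hom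
  have hc : Function.Bijective c :=
    ConcreteCategory.bijective_of_isIso
      (Y.presheaf.stalkCongr (Inseparable.of_eq hη.symm)).hom
  let E : Y.functionField ≃+* X.functionField := RingEquiv.ofBijective (φ.comp c) (hbir.comp hc)
  letI algτ : Algebra (Y.presheaf.stalk (f.base x)) X.functionField :=
    ((algebraMap (X.presheaf.stalk x) X.functionField).comp (f.stalkMap x).hom).toAlgebra
  have hτ : ∀ a, algebraMap (Y.presheaf.stalk (f.base x)) X.functionField a =
      φ (Y.presheaf.stalkSpecializes hfx a) := fun a => by
    change (X.presheaf.stalkSpecializes hgx).hom ((f.stalkMap x).hom a) = _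
    exact (Scheme.Hom.stalkSpecializes_stalkMap_apply f (genericPoint X) x hgx a).symm
  have hE : ∀ a, E (algebraMap (Y.presheaf.stalk (f.base x)) Y.functionField a) =
      algebraMap (Y.presheaf.stalk (f.base x)) X.functionField a := by
    intro a
    rw [hτ]
    change φ (c ((Y.presheaf.stalkSpecializes hgy).hom a)) = _
    congr 1
    change (Y.presheaf.stalkSpecializes hgy ≫ Y.presheaf.stalkSpecializes h₀).hom a = _
    rw [TopCat.Presheaf.stalkSpecializes_comp]
  let E' : Y.functionField ≃ₐ[Y.presheaf.stalk (f.base x)] X.functionField :=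
    { E with commutes' := hE }
  haveI hfr : IsFractionRing (Y.presheaf.stalk (f.base x)) X.functionField :=
    IsLocalization.isLocalization_of_algEquiv _ E'
  refine ⟨?_, stalkMap_surjective_of_forall_ringKrullDim_le_one f x hreg hfr
    (fun x' _ hx' => h1 x' hx')⟩
  have hinjτ : Function.Injective (algebraMap (Y.presheaf.stalk (f.base x)) X.functionField) :=
    IsFractionRing.injective _ _
  exact Function.Injective.of_comp hinjτ

/-! ### Injectivity from invertible stalk maps, and the isomorphism criterion -/

/-- **Two points of an integral scheme with the same image and invertible stalk maps under a
separated morphism coincide.**  If `f : X → Y` is separated, `X` integral, `f(x₁) = f(x₂)` and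
`𝒪_{Y,f(xᵢ)} → 𝒪_{X,xᵢ}` is bijective for `i = 1, 2`, then `x₁ = x₂`: the two lifts
`Spec 𝒪_{Y,y} ≅ Spec 𝒪_{X,xᵢ} → X` of `Spec 𝒪_{Y,y} → Y` agree at the generic point, hence
everywhere (`f` separated, source integral), and their closed points are `x₁`, `x₂`.
[cite: EGAIV4, 21.12.12] [cite: StacksProject, Tag 01KM] -/
theorem eq_of_apply_eq_of_isIso_stalkMap [IsIntegral X] [IsIntegral Y] [IsSeparated f] {x₁ x₂ : X}
    (hx : f.base x₁ = f.base x₂) [IsIso (f.stalkMap x₁)] [IsIso (f.stalkMap x₂)] : x₁ = x₂ := by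
  -- the two candidate lifts `T = Spec 𝒪_{Y, f x₁} → X`
  let σ₁ := f.stalkMap x₁
  let c : Y.presheaf.stalk (f.base x₁) ⟶ Y.presheaf.stalk (f.base x₂) :=
    Y.presheaf.stalkSpecializes (specializes_of_eq hx.symm)
  haveI : IsIso c := inferInstanceAs (IsIso (Y.presheaf.stalkCongr (Inseparable.of_eq hx)).hom)
  let σ₂ := c ≫ f.stalkMap x₂
  let h₁ : Spec (Y.presheaf.stalk (f.base x₁)) ⟶ X := Spec.map (inv σ₁) ≫ X.fromSpecStalk x₁
  let h₂ : Spec (Y.presheaf.stalk (f.base x₁)) ⟶ X := Spec.map (inv σ₂) ≫ X.fromSpecStalk x₂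
  have hc : Spec.map c ≫ Y.fromSpecStalk (f.base x₁) = Y.fromSpecStalk (f.base x₂) :=
    Scheme.SpecMap_stalkSpecializes_fromSpecStalk (specializes_of_eq hx.symm)
  have e₁ : h₁ ≫ f = Y.fromSpecStalk (f.base x₁) := by
    change (Spec.map (inv σ₁) ≫ X.fromSpecStalk x₁) ≫ f = _
    rw [Category.assoc, ← Scheme.SpecMap_stalkMap_fromSpecStalk f (x := x₁),
      ← Spec.map_comp_assoc]
    change Spec.map (σ₁ ≫ inv σ₁) ≫ _ = _
    rw [IsIso.hom_inv_id, Spec.map_id, Category.id_comp]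
  have e₂ : h₂ ≫ f = Y.fromSpecStalk (f.base x₁) := by
    change (Spec.map (inv σ₂) ≫ X.fromSpecStalk x₂) ≫ f = _
    rw [Category.assoc, ← Scheme.SpecMap_stalkMap_fromSpecStalk f (x := x₂), ← hc,
      ← Spec.map_comp_assoc, ← Spec.map_comp_assoc]
    change Spec.map (σ₂ ≫ inv σ₂) ≫ _ = _
    rw [IsIso.hom_inv_id, Spec.map_id, Category.id_comp]
  -- they agree at the generic point of `X`
  let η := genericPoint X
  have hg₁ : η ⤳ x₁ := genericPoint_specializes x₁
  have hg₂ : η ⤳ x₂ := genericPoint_specializes x₂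
  let ι : Spec (X.presheaf.stalk η) ⟶ Spec (Y.presheaf.stalk (f.base x₁)) :=
    Spec.map (σ₁ ≫ X.presheaf.stalkSpecializes hg₁)
  haveI : IsDominant ι := by
    rw [isDominant_iff]
    refine (PrimeSpectrum.denseRange_comap_iff_ker_le_nilRadical _).mpr ?_
    intro a ha
    rw [RingHom.mem_ker] at ha
    have hinj : Function.Injective (σ₁ ≫ X.presheaf.stalkSpecializes hg₁).hom := by
      rw [CommRingCat.hom_comp, RingHom.coe_comp]
      refine Function.Injective.comp ?_ (ConcreteCategory.bijective_of_isIso σ₁).1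
      exact IsFractionRing.injective (X.presheaf.stalk x₁) X.functionField
    have : a = 0 := hinj (by rw [ha, map_zero])
    rw [this]
    exact Ideal.zero_mem _
  have key : σ₁ ≫ X.presheaf.stalkSpecializes hg₁ = σ₂ ≫ X.presheaf.stalkSpecializes hg₂ := by
    change f.stalkMap x₁ ≫ X.presheaf.stalkSpecializes hg₁ =
      (c ≫ f.stalkMap x₂) ≫ X.presheaf.stalkSpecializes hg₂
    rw [← Scheme.Hom.stalkSpecializes_stalkMap f η x₁ hg₁, Category.assoc,
      ← Scheme.Hom.stalkSpecializes_stalkMap f η x₂ hg₂, ← Category.assoc,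
      TopCat.Presheaf.stalkSpecializes_comp]
  have hι₁ : ι ≫ h₁ = X.fromSpecStalk η := by
    change Spec.map (σ₁ ≫ X.presheaf.stalkSpecializes hg₁) ≫ Spec.map (inv σ₁) ≫
      X.fromSpecStalk x₁ = _
    rw [← Spec.map_comp_assoc, IsIso.inv_hom_id_assoc, Scheme.SpecMap_stalkSpecializes_fromSpecStalk]
  have hι₂ : ι ≫ h₂ = X.fromSpecStalk η := by
    change Spec.map (σ₁ ≫ X.presheaf.stalkSpecializes hg₁) ≫ Spec.map (inv σ₂) ≫
      X.fromSpecStalk x₂ = _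
    rw [key, ← Spec.map_comp_assoc, IsIso.inv_hom_id_assoc,
      Scheme.SpecMap_stalkSpecializes_fromSpecStalk]
  have heq : h₁ = h₂ :=
    ext_of_isDominant_of_isSeparated f (e₁.trans e₂.symm) ι (hι₁.trans hι₂.symm)
  -- evaluate at the closed point
  have hc₁ : h₁.base (closedPoint (Y.presheaf.stalk (f.base x₁))) = x₁ := by
    have h0 : (Spec.map σ₁).base (closedPoint (X.presheaf.stalk x₁)) =
        closedPoint (Y.presheaf.stalk (f.base x₁)) := Spec_closedPoint
    rw [← h0, ← Scheme.Hom.comp_apply, ← Category.assoc, ← Spec.map_comp, IsIso.inv_hom_id,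
      Spec.map_id, Category.id_comp]
    exact Scheme.fromSpecStalk_closedPoint
  have hc₂ : h₂.base (closedPoint (Y.presheaf.stalk (f.base x₁))) = x₂ := by
    haveI : IsLocalHom σ₂.hom := isLocalHom_of_isIso _
    have h0 : (Spec.map σ₂).base (closedPoint (X.presheaf.stalk x₂)) =
        closedPoint (Y.presheaf.stalk (f.base x₁)) := Spec_closedPoint
    rw [← h0, ← Scheme.Hom.comp_apply, ← Category.assoc, ← Spec.map_comp, IsIso.inv_hom_id,
      Spec.map_id, Category.id_comp]
    exact Scheme.fromSpecStalk_closedPoint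
  rw [← hc₁, ← hc₂, heq]

/-- **A proper birational morphism onto a regular scheme which is a local isomorphism in
codimension one is an isomorphism** (van der Waerden purity + Zariski's Main Theorem).  Let
`f : X → Y` be proper and birational between integral schemes, `X` locally noetherian, `Y`
regular.  If `𝒪_{Y,f(x)} → 𝒪_{X,x}` is surjective at every point `x` with `dim 𝒪_{X,x} ≤ 1`, then
`f` is an isomorphism: by purity all stalk maps are bijective, so `f` is injective
(`eq_of_apply_eq_of_isIso_stalkMap`), hence quasi-finite, hence finite (Zariski), and a finite birational
morphism onto a normal scheme is an isomorphism.
[cite: EGAIV4, 21.12.12] [cite: StacksProject, Tag 02LQ] -/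
theorem isIso_of_isProper_of_isBirational_of_forall_ringKrullDim_le_one [IsIntegral X]
    [IsLocallyNoetherian X] [IsIntegral Y] [IsProper f] (hf : IsBirational f)
    (hY : ∀ y : Y, IsRegularLocalRing (Y.presheaf.stalk y))
    (h1 : ∀ x : X, ringKrullDim (X.presheaf.stalk x) ≤ 1 → Function.Surjective (f.stalkMap x)) :
    IsIso f := by
  haveI : IsDominant f := hf.isDominant
  have hη : f.base (genericPoint X) = genericPoint Y := genericPoint_eq_of_isDominant f
  have hbir : Function.Bijective (f.stalkMap (genericPoint X)) := by
    haveI := hf.isIso_stalkMap_genericPoint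
    exact ConcreteCategory.bijective_of_isIso (f.stalkMap (genericPoint X))
  have hall : ∀ x, IsIso (f.stalkMap x) := fun x =>
    (ConcreteCategory.isIso_iff_bijective (f.stalkMap x)).mpr
      (stalkMap_bijective_of_forall_ringKrullDim_le_one f hη hbir h1 x (hY _))
  have hinj : Function.Injective f.base := by
    intro x₁ x₂ hx
    haveI := hall x₁
    haveI := hall x₂
    exact eq_of_apply_eq_of_isIso_stalkMap f hx
  haveI : LocallyQuasiFinite f := LocallyQuasiFinite.of_injective hinj
  haveI : IsFinite f := IsFinite.of_isProper_of_locallyQuasiFinite f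
  have hY' : ∀ y : Y, IsIntegrallyClosed (Y.presheaf.stalk y) := fun y => by
    haveI := isDomain_of_isRegularLocalRing (Y.presheaf.stalk y)
    haveI := uniqueFactorizationMonoid_of_isRegularLocalRing (Y.presheaf.stalk y) (hY y)
    infer_instance
  exact isIso_of_isFinite_of_isBirational f hY' hf

end Literature.AlgebraicGeometry.Resolution

end
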